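import Mathlib.Data.ZMod.Basic
import Mathlib.Algebra.BigOperators.Fin
import Mathlib.Algebra.BigOperators.Ring.Finset
import Mathlib.Tactic.Ring

/-!
# Crux `CubicForrelation.NearExactIsExact` (stmt-QuantumAdvantage-14043) — n = 12, E1280-even, R4 half, descendant 0 / w = 3: the BOOKKEEPING
  from the pairing-partner equations in the normal form `d = y∧(v₀v₁+v₂v₃) + v₀∧(Ξ + Σ_t v_t∧y_t)` to the identities of E1280-HANDPROOFS.md §2.4(ii)

Certificate seat `b2b-cforr-cert` (gen 39).  HONEST FRAMING: kernel-checked Finset algebra (standard axioms), Mathlib-only; the R4 analogue of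
…TwelvePartnerR2Blocks.  By itself it says nothing about `θ₁₂`; NOT summit progress.

SETTING.  Indices `Fin (5 + 7)`: `κ a := Fin.castAdd 7 a` (`a : Fin 5`; `κ 0 = y`, `κ (t+1) = v_t`) and `σ j := Fin.natAdd 5 j` (`j : Fin 7`,
the `z`-coordinates).  `c, d` are the coefficient tensors (symmetric under the two transpositions, zero on repeated indices) with the partner
equations `hpair`.  The normal form of the light R4 leaf "descendant 0, hyperplane section" (HANDPROOFS §2.4(i)) is given through the slices
of `d`: `hdy` (slice at `y` = `v₀v₁ + v₂v₃`), `hdv0` (slice at `v₀` = `y v₁ + Ξ + Σ_t v_t∧y_t`), `hdv` (slice at `v_t` = `y v_{t̄} + v₀∧y_t`,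
`t = 1,2,3`, `t̄` the ω-partner), `hdz` (slice at `z_j` = `v₀ ∧ (Ξ_j + Σ_t y_t[j] v_t)`).
RESULTS (`tpc4_*`): the generic split `tpc4_sum_lt_split` of `Σ_{j<k}` over `Fin (m + n)`; and from `hpair`: `c_{v v v} = 0` (`tpc4_cvvv`),
`(Z)`: `(N Ξ)_{mj} + Σ_t κ_t[m] y_t[j] = [m = j]`, `(R)`: `Ξ κ_t = 0`, and the scalar identities `(y,y)`, `(v₀,v₂)`, `(v₀,v₃)`, `(v_t,v_t)`,
`(v₂,v₁)`, `(v₂,v₃)`, `(v₃,v₁)`, `(v₃,v₂)`, `(v₀,v₀)` — exactly the hypotheses of `tpl_R4_Z_rank4_core` / `tpl_R4_Z_rank6_core`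
(…TwelvePartnerLeaves), with `g₁ = c_{y v₀ v₁}`, `c₂₃ = c_{y v₂ v₃}`, `κ_t[j] = c_{v₀ v_t z_j}`, `N_{jk} = c_{v₀ z_j z_k}`.

References: this work (cert seats g36–g39).  Axioms: the standard three.
-/

set_option linter.dupNamespace false -- D-0017: single-problem summit ⇒ `QuantumAdvantage.QuantumAdvantage` by design

namespace Summit.QuantumAdvantage.QuantumAdvantage.Theorems.CubicForrelation.NearExactIsExact

open Finset Matrix

/-- Splitting `Σ_{j<k}` over `Fin (m + n)` into the three blocks (general `m`). [this work] -/
theorem tpc4_sum_lt_split {R : Type*} [AddCommMonoid R] {m n : ℕ} (F : Fin (m + n) → Fin (m + n) → R) :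
    (∑ j, ∑ k, (if j < k then F j k else 0)) =
      (∑ a : Fin m, ∑ b : Fin m, (if a < b then F (Fin.castAdd n a) (Fin.castAdd n b) else 0)) +
      (∑ a : Fin m, ∑ s : Fin n, F (Fin.castAdd n a) (Fin.natAdd m s)) +
      ∑ s : Fin n, ∑ t : Fin n, (if s < t then F (Fin.natAdd m s) (Fin.natAdd m t) else 0) := by
  have hyy : ∀ a b : Fin m, (Fin.castAdd n a < Fin.castAdd n b) ↔ a < b := fun a b => by
    rw [Fin.lt_def, Fin.lt_def]; simp only [Fin.val_castAdd]
  have hys : ∀ (a : Fin m) (s : Fin n), Fin.castAdd n a < Fin.natAdd m s := fun a s => by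
    rw [Fin.lt_def]; simp only [Fin.val_castAdd, Fin.val_natAdd]; omega
  have hsy : ∀ (s : Fin n) (a : Fin m), ¬ Fin.natAdd m s < Fin.castAdd n a := fun s a => by
    rw [Fin.lt_def]; simp only [Fin.val_castAdd, Fin.val_natAdd]; omega
  have hss : ∀ s t : Fin n, (Fin.natAdd m s < Fin.natAdd m t) ↔ s < t := fun s t => by
    rw [Fin.lt_def, Fin.lt_def]; simp only [Fin.val_natAdd]; omega
  have hin1 : ∀ a : Fin m, (∑ k : Fin (m + n), (if Fin.castAdd n a < k then F (Fin.castAdd n a) k else 0)) =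
      (∑ b : Fin m, (if a < b then F (Fin.castAdd n a) (Fin.castAdd n b) else 0)) + ∑ s : Fin n, F (Fin.castAdd n a) (Fin.natAdd m s) := by
    intro a
    rw [Fin.sum_univ_add]
    exact congrArg₂ (· + ·)
      (Finset.sum_congr rfl fun b _ => by
        by_cases h : a < b
        · rw [if_pos ((hyy a b).2 h), if_pos h]
        · rw [if_neg (fun h' => h ((hyy a b).1 h')), if_neg h])
      (Finset.sum_congr rfl fun s _ => by rw [if_pos (hys a s)])
  have hin2 : ∀ s : Fin n, (∑ k : Fin (m + n), (if Fin.natAdd m s < k then F (Fin.natAdd m s) k else 0)) =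
      ∑ t : Fin n, (if s < t then F (Fin.natAdd m s) (Fin.natAdd m t) else 0) := by
    intro s
    rw [Fin.sum_univ_add, Finset.sum_eq_zero (fun b _ => if_neg (hsy s b)), zero_add]
    exact Finset.sum_congr rfl fun t _ => by
      by_cases h : s < t
      · rw [if_pos ((hss s t).2 h), if_pos h]
      · rw [if_neg (fun h' => h ((hss s t).1 h')), if_neg h]
  rw [Fin.sum_univ_add, Finset.sum_congr rfl fun a _ => hin1 a, Finset.sum_congr rfl fun s _ => hin2 s, Finset.sum_add_distrib]

/-- Pairing a coefficient matrix against the wedge of two distinct basis covectors picks out one entry (any commutative ring). [this work] -/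
theorem tpc4_pair_basis_wedge {R : Type*} [CommRing R] {n : ℕ} (X : Fin n → Fin n → R) (a b : Fin n) (hab : a < b) :
    (∑ s, ∑ t, (if s < t then X s t * (if (s = a ∧ t = b) ∨ (s = b ∧ t = a) then 1 else 0) else 0)) = X a b := by
  rw [Finset.sum_eq_single a]
  · rw [Finset.sum_eq_single b]
    · rw [if_pos hab, if_pos (Or.inl ⟨rfl, rfl⟩), mul_one]
    · intro t _ htb
      by_cases hlt : a < t
      · rw [if_pos hlt, if_neg, mul_zero]
        rintro (⟨-, h1⟩ | ⟨-, h1⟩)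
        · exact htb h1
        · rw [h1] at hlt; exact lt_irrefl _ hlt
      · rw [if_neg hlt]
    · intro h0; exact absurd (Finset.mem_univ _) h0
  · intro s _ hsa
    refine Finset.sum_eq_zero fun t _ => ?_
    by_cases hlt : s < t
    · rw [if_pos hlt, if_neg, mul_zero]
      rintro (⟨h1, -⟩ | ⟨h1, h2⟩)
      · exact hsa h1
      · rw [h1, h2] at hlt; exact lt_asymm hab hlt
    · rw [if_neg hlt]
  · intro h0; exact absurd (Finset.mem_univ _) h0

section R4Z

variable (c d : Fin (5 + 7) → Fin (5 + 7) → Fin (5 + 7) → ZMod 2)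
  (hcs : ∀ p j k, c p k j = c p j k) (hcc : ∀ p j k, c j p k = c p j k) (hcd : ∀ p j, c p j j = 0)
  (hpair : ∀ p φ, (∑ j, ∑ k, (if j < k then c p j k * d φ j k else 0)) = if p = φ then 1 else 0)
  (Ξ : Fin 7 → Fin 7 → ZMod 2) (hΞs : ∀ j k, Ξ k j = Ξ j k) (Y : Fin 3 → Fin 7 → ZMod 2)
  -- partner of `v_t` inside ω = v₀v₁ + v₂v₃, as an index of Fin 5 (`y = 0`, `v_i = i + 1`): v₁ ↦ v₀ = 1, v₂ ↦ v₃ = 4, v₃ ↦ v₂ = 3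
  -- slice at y: v₀∧v₁ + v₂∧v₃
  (hdy_κκ : ∀ a b : Fin 5, d (Fin.castAdd 7 0) (Fin.castAdd 7 a) (Fin.castAdd 7 b) =
    (if (a = 1 ∧ b = 2) ∨ (a = 2 ∧ b = 1) then 1 else 0) + (if (a = 3 ∧ b = 4) ∨ (a = 4 ∧ b = 3) then 1 else 0))
  (hdy_κσ : ∀ (a : Fin 5) (s : Fin 7), d (Fin.castAdd 7 0) (Fin.castAdd 7 a) (Fin.natAdd 5 s) = 0)
  (hdy_σσ : ∀ s u : Fin 7, d (Fin.castAdd 7 0) (Fin.natAdd 5 s) (Fin.natAdd 5 u) = 0)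
  -- slice at v₀: y∧v₁ + Ξ + Σ_t v_t ∧ y_t
  (hdv0_κκ : ∀ a b : Fin 5, d (Fin.castAdd 7 1) (Fin.castAdd 7 a) (Fin.castAdd 7 b) = if (a = 0 ∧ b = 2) ∨ (a = 2 ∧ b = 0) then 1 else 0)
  (hdv0_κσ : ∀ (a : Fin 5) (s : Fin 7), d (Fin.castAdd 7 1) (Fin.castAdd 7 a) (Fin.natAdd 5 s) =
    ∑ t : Fin 3, (if a = Fin.natAdd 2 t then Y t s else 0))
  (hdv0_σσ : ∀ s u : Fin 7, d (Fin.castAdd 7 1) (Fin.natAdd 5 s) (Fin.natAdd 5 u) = Ξ s u)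
  -- slices at v_t (t : Fin 3; index Fin.natAdd 2 t = t + 2): y ∧ v_{t̄} + v₀ ∧ y_t
  (hdv_κκ : ∀ (t : Fin 3) (a b : Fin 5), d (Fin.castAdd 7 (Fin.natAdd 2 t)) (Fin.castAdd 7 a) (Fin.castAdd 7 b) =
    if (a = 0 ∧ b = ![1, 4, 3] t) ∨ (a = ![1, 4, 3] t ∧ b = 0) then 1 else 0)
  (hdv_κσ : ∀ (t : Fin 3) (a : Fin 5) (s : Fin 7), d (Fin.castAdd 7 (Fin.natAdd 2 t)) (Fin.castAdd 7 a) (Fin.natAdd 5 s) =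
    if a = 1 then Y t s else 0)
  (hdv_σσ : ∀ (t : Fin 3) (s u : Fin 7), d (Fin.castAdd 7 (Fin.natAdd 2 t)) (Fin.natAdd 5 s) (Fin.natAdd 5 u) = 0)
  -- slices at z_j: v₀ ∧ (Ξ_j + Σ_t y_t[j] v_t)
  (hdz_κκ : ∀ (j : Fin 7) (a b : Fin 5), d (Fin.natAdd 5 j) (Fin.castAdd 7 a) (Fin.castAdd 7 b) =
    ∑ t : Fin 3, (if (a = 1 ∧ b = Fin.natAdd 2 t) ∨ (a = Fin.natAdd 2 t ∧ b = 1) then Y t j else 0))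
  (hdz_κσ : ∀ (j : Fin 7) (a : Fin 5) (s : Fin 7), d (Fin.natAdd 5 j) (Fin.castAdd 7 a) (Fin.natAdd 5 s) = if a = 1 then Ξ j s else 0)
  (hdz_σσ : ∀ (j : Fin 7) (s u : Fin 7), d (Fin.natAdd 5 j) (Fin.natAdd 5 s) (Fin.natAdd 5 u) = 0)

include hpair hdy_κκ hdy_κσ hdy_σσ in
/-- The partner equations at `φ = y`: `c_{p v₀ v₁} + c_{p v₂ v₃} = [p = y]`. [this work] -/
theorem tpc4_key_y (p : Fin (5 + 7)) :
    c p (Fin.castAdd 7 1) (Fin.castAdd 7 2) + c p (Fin.castAdd 7 3) (Fin.castAdd 7 4) = if p = Fin.castAdd 7 0 then 1 else 0 := by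
  have h := hpair p (Fin.castAdd 7 0)
  rw [tpc4_sum_lt_split] at h
  simp only [hdy_κσ, hdy_σσ, mul_zero, Finset.sum_const_zero, ite_self, add_zero] at h
  simp only [hdy_κκ, mul_add] at h
  have hsplit : ∀ a b : Fin 5, (if a < b then c p (Fin.castAdd 7 a) (Fin.castAdd 7 b) *
      (if (a = 1 ∧ b = 2) ∨ (a = 2 ∧ b = 1) then (1 : ZMod 2) else 0) +
      c p (Fin.castAdd 7 a) (Fin.castAdd 7 b) * (if (a = 3 ∧ b = 4) ∨ (a = 4 ∧ b = 3) then (1 : ZMod 2) else 0) else 0) =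
      (if a < b then c p (Fin.castAdd 7 a) (Fin.castAdd 7 b) * (if (a = 1 ∧ b = 2) ∨ (a = 2 ∧ b = 1) then (1 : ZMod 2) else 0) else 0) +
      (if a < b then c p (Fin.castAdd 7 a) (Fin.castAdd 7 b) * (if (a = 3 ∧ b = 4) ∨ (a = 4 ∧ b = 3) then (1 : ZMod 2) else 0) else 0) := by
    intro a b; split_ifs <;> simp
  rw [Finset.sum_congr rfl fun a _ => Finset.sum_congr rfl fun b _ => hsplit a b] at h
  simp only [Finset.sum_add_distrib] at h
  rw [tpc4_pair_basis_wedge (fun a b => c p (Fin.castAdd 7 a) (Fin.castAdd 7 b)) 1 2 (by decide),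
    tpc4_pair_basis_wedge (fun a b => c p (Fin.castAdd 7 a) (Fin.castAdd 7 b)) 3 4 (by decide)] at h
  exact h

include hpair hdv0_κκ hdv0_κσ hdv0_σσ in
/-- The partner equations at `φ = v₀`. [this work] -/
theorem tpc4_key_v0 (p : Fin (5 + 7)) :
    c p (Fin.castAdd 7 0) (Fin.castAdd 7 2) +
      (∑ t : Fin 3, ∑ s : Fin 7, c p (Fin.castAdd 7 (Fin.natAdd 2 t)) (Fin.natAdd 5 s) * Y t s) +
      (∑ s : Fin 7, ∑ u : Fin 7, (if s < u then c p (Fin.natAdd 5 s) (Fin.natAdd 5 u) * Ξ s u else 0)) =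
      if p = Fin.castAdd 7 1 then 1 else 0 := by
  have h := hpair p (Fin.castAdd 7 1)
  rw [tpc4_sum_lt_split] at h
  simp only [hdv0_κκ, hdv0_σσ] at h
  rw [tpc4_pair_basis_wedge (fun a b => c p (Fin.castAdd 7 a) (Fin.castAdd 7 b)) 0 2 (by decide)] at h
  rw [← h]
  congr 2
  -- the κσ block
  simp only [hdv0_κσ, Finset.mul_sum, mul_ite, mul_zero]
  rw [Finset.sum_comm]
  symm
  rw [Finset.sum_comm]
  refine Finset.sum_congr rfl fun s _ => ?_
  rw [Finset.sum_comm]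
  refine Finset.sum_congr rfl fun t _ => ?_
  rw [Finset.sum_ite_eq' Finset.univ (Fin.natAdd 2 t)]
  simp

include hpair hdv_κκ hdv_κσ hdv_σσ in
/-- The partner equations at `φ = v_t` (`t = 1,2,3` as `Fin 3`; partner index `![1,4,3] t`). [this work] -/
theorem tpc4_key_vt (t : Fin 3) (p : Fin (5 + 7)) :
    c p (Fin.castAdd 7 0) (Fin.castAdd 7 (![1, 4, 3] t)) + (∑ s : Fin 7, c p (Fin.castAdd 7 1) (Fin.natAdd 5 s) * Y t s) =
      if p = Fin.castAdd 7 (Fin.natAdd 2 t) then 1 else 0 := by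
  have h := hpair p (Fin.castAdd 7 (Fin.natAdd 2 t))
  rw [tpc4_sum_lt_split] at h
  simp only [hdv_κκ, hdv_σσ, mul_zero, ite_self, Finset.sum_const_zero, add_zero] at h
  have hlt : (0 : Fin 5) < ![1, 4, 3] t := by fin_cases t <;> decide
  rw [tpc4_pair_basis_wedge (fun a b => c p (Fin.castAdd 7 a) (Fin.castAdd 7 b)) 0 _ hlt] at h
  rw [← h]
  congr 1
  simp only [hdv_κσ, mul_ite, mul_zero]
  rw [Finset.sum_comm]
  refine Finset.sum_congr rfl fun s _ => ?_
  rw [Finset.sum_ite_eq' Finset.univ (1 : Fin 5)]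
  simp

include hpair hdz_κκ hdz_κσ hdz_σσ in
/-- The partner equations at `φ = z_j`. [this work] -/
theorem tpc4_key_z (j : Fin 7) (p : Fin (5 + 7)) :
    (∑ t : Fin 3, c p (Fin.castAdd 7 1) (Fin.castAdd 7 (Fin.natAdd 2 t)) * Y t j) +
      (∑ s : Fin 7, c p (Fin.castAdd 7 1) (Fin.natAdd 5 s) * Ξ j s) = if p = Fin.natAdd 5 j then 1 else 0 := by
  have h := hpair p (Fin.natAdd 5 j)
  rw [tpc4_sum_lt_split] at h
  simp only [hdz_σσ, mul_zero, ite_self, Finset.sum_const_zero, add_zero] at h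
  rw [← h]
  congr 1
  · -- κκ block: a sum of three wedges weighted by Y t j
    simp only [hdz_κκ, Finset.mul_sum]
    have hterm : ∀ a b : Fin 5, (if a < b then ∑ t : Fin 3, c p (Fin.castAdd 7 a) (Fin.castAdd 7 b) *
        (if (a = 1 ∧ b = Fin.natAdd 2 t) ∨ (a = Fin.natAdd 2 t ∧ b = 1) then Y t j else 0) else 0) =
        ∑ t : Fin 3, Y t j * (if a < b then c p (Fin.castAdd 7 a) (Fin.castAdd 7 b) *
          (if (a = 1 ∧ b = Fin.natAdd 2 t) ∨ (a = Fin.natAdd 2 t ∧ b = 1) then 1 else 0) else 0) := by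
      intro a b
      by_cases hab : a < b
      · simp only [hab, if_true]
        refine Finset.sum_congr rfl fun t _ => ?_
        split_ifs <;> ring
      · simp only [hab, if_false, mul_zero, Finset.sum_const_zero]
    rw [Finset.sum_congr rfl fun a _ => Finset.sum_congr rfl fun b _ => hterm a b]
    rw [Finset.sum_congr rfl fun a _ => Finset.sum_comm, Finset.sum_comm]
    refine Finset.sum_congr rfl fun t _ => ?_
    simp only [← Finset.mul_sum]
    have hlt : (1 : Fin 5) < Fin.natAdd 2 t := by
      rw [Fin.lt_def]; simp only [Fin.val_natAdd]; show 1 < 2 + (t : ℕ); omega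
    rw [tpc4_pair_basis_wedge (fun a b => c p (Fin.castAdd 7 a) (Fin.castAdd 7 b)) 1 _ hlt]
    ring
  · simp only [hdz_κσ, mul_ite, mul_zero]
    rw [Finset.sum_comm]
    refine Finset.sum_congr rfl fun s _ => ?_
    rw [Finset.sum_ite_eq' Finset.univ (1 : Fin 5)]
    simp

/-- A tensor on `Fin (5+7)` symmetric under both transpositions with zero diagonal vanishes on repeated indices. -/
theorem tpc4_diag12 (e : Fin (5 + 7) → Fin (5 + 7) → Fin (5 + 7) → ZMod 2)
    (hs : ∀ φ j k, e φ k j = e φ j k) (hc : ∀ φ j k, e j φ k = e φ j k) (hd : ∀ φ j, e φ j j = 0)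
    (φ k : Fin (5 + 7)) : e φ φ k = 0 ∧ e φ k φ = 0 := by
  have h1 : e φ φ k = 0 := by rw [hs φ k φ, hc k φ φ, hd]
  exact ⟨h1, by rw [hs φ φ k]; exact h1⟩

include hcs hcc hcd hpair hdy_κκ hdy_κσ hdy_σσ hdv0_κκ hdv0_κσ hdv0_σσ hdv_κκ hdv_κσ hdv_σσ hdz_κκ hdz_κσ hdz_σσ

omit hdv0_κκ hdv0_κσ hdv0_σσ hdv_κκ hdv_κσ hdv_σσ hdz_κκ hdz_κσ hdz_σσ in
/-- `c_{v v v} = 0` for all triples of `v`-indices meeting ω's pairs suitably — here the four that occur: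
`c_{v₀v₂v₃} = c_{v₁v₂v₃} = c_{v₂v₀v₁} = c_{v₃v₀v₁} = 0` (the equations at `(v_a, y)`), and `(y,y)`: `c_{yv₀v₁} + c_{yv₂v₃} = 1`. [this work] -/
theorem tpc4_cvvv :
    c (Fin.castAdd 7 1) (Fin.castAdd 7 3) (Fin.castAdd 7 4) = 0 ∧ c (Fin.castAdd 7 2) (Fin.castAdd 7 3) (Fin.castAdd 7 4) = 0 ∧
    c (Fin.castAdd 7 3) (Fin.castAdd 7 1) (Fin.castAdd 7 2) = 0 ∧ c (Fin.castAdd 7 4) (Fin.castAdd 7 1) (Fin.castAdd 7 2) = 0 ∧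
    c (Fin.castAdd 7 0) (Fin.castAdd 7 1) (Fin.castAdd 7 2) + c (Fin.castAdd 7 0) (Fin.castAdd 7 3) (Fin.castAdd 7 4) = 1 := by
  have hk := tpc4_key_y c d hpair hdy_κκ hdy_κσ hdy_σσ
  have hc := tpc4_diag12 c hcs hcc hcd
  have ne : ∀ a : Fin 5, a ≠ 0 → (Fin.castAdd 7 a : Fin (5 + 7)) ≠ Fin.castAdd 7 0 := fun a ha h => ha (Fin.castAdd_injective _ _ h)
  refine ⟨?_, ?_, ?_, ?_, ?_⟩
  · have h := hk (Fin.castAdd 7 1); rw [if_neg (ne 1 (by decide)), (hc _ _).1, zero_add] at h; exact h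
  · have h := hk (Fin.castAdd 7 2); rw [if_neg (ne 2 (by decide)), (hc _ _).2, zero_add] at h; exact h
  · have h := hk (Fin.castAdd 7 3); rw [if_neg (ne 3 (by decide)), (hc _ _).1, add_zero] at h; exact h
  · have h := hk (Fin.castAdd 7 4); rw [if_neg (ne 4 (by decide)), (hc _ _).2, add_zero] at h; exact h
  · have h := hk (Fin.castAdd 7 0); rwa [if_pos rfl] at h

include hΞs in
omit hcd hdy_κκ hdy_κσ hdy_σσ hdv0_κκ hdv0_κσ hdv0_σσ hdv_κκ hdv_κσ hdv_σσ in
/-- **(Z)**: `(N Ξ)_{mj} + Σ_t κ_t[m] y_t[j] = [m = j]` with `N_{ms} = c_{v₀ z_m z_s}`, `κ_t[m] = c_{v₀ v_t z_m}` — the equations at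
`(z_m, z_j)`. [this work] -/
theorem tpc4_Z (m j : Fin 7) :
    (∑ s : Fin 7, c (Fin.castAdd 7 1) (Fin.natAdd 5 m) (Fin.natAdd 5 s) * Ξ s j) +
      (∑ t : Fin 3, c (Fin.castAdd 7 1) (Fin.castAdd 7 (Fin.natAdd 2 t)) (Fin.natAdd 5 m) * Y t j) = if m = j then 1 else 0 := by
  have h := tpc4_key_z c d hpair Ξ Y hdz_κκ hdz_κσ hdz_σσ j (Fin.natAdd 5 m)
  have hiff : (Fin.natAdd 5 m : Fin (5 + 7)) = Fin.natAdd 5 j ↔ m = j :=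
    ⟨fun h' => by have := congrArg Fin.val h'; simp only [Fin.val_natAdd] at this; exact Fin.ext (by omega), fun h' => h' ▸ rfl⟩
  simp only [hiff] at h
  rw [← h, add_comm]
  congr 1
  · refine Finset.sum_congr rfl fun t _ => ?_
    rw [hcc (Fin.castAdd 7 1) (Fin.natAdd 5 m) (Fin.castAdd 7 (Fin.natAdd 2 t)), hcs (Fin.castAdd 7 1) (Fin.castAdd 7 (Fin.natAdd 2 t)) (Fin.natAdd 5 m)]
  · refine Finset.sum_congr rfl fun s _ => ?_
    rw [hcc (Fin.castAdd 7 1) (Fin.natAdd 5 m) (Fin.natAdd 5 s), hΞs j s]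

omit hpair hdy_κκ hdy_κσ hdy_σσ hdv0_κκ hdv0_κσ hdv0_σσ hdv_κκ hdv_κσ hdv_σσ hdz_κκ hdz_κσ hdz_σσ in
/-- Full symmetry bookkeeping: from the three vanishing `c_{v v v}` entries of `tpc4_cvvv`, every `c_{v₀ v_t v_{t'}}` vanishes. -/
theorem tpc4_cv0vv (h134 : c (Fin.castAdd 7 1) (Fin.castAdd 7 3) (Fin.castAdd 7 4) = 0)
    (h312 : c (Fin.castAdd 7 3) (Fin.castAdd 7 1) (Fin.castAdd 7 2) = 0) (h412 : c (Fin.castAdd 7 4) (Fin.castAdd 7 1) (Fin.castAdd 7 2) = 0)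
    (a b : Fin 5) (ha : a = 2 ∨ a = 3 ∨ a = 4) (hb : b = 2 ∨ b = 3 ∨ b = 4) :
    c (Fin.castAdd 7 a) (Fin.castAdd 7 1) (Fin.castAdd 7 b) = 0 := by
  have hc := tpc4_diag12 c hcs hcc hcd
  -- normalise to `c v₀ a b` with the three known zeros
  have h123 : c (Fin.castAdd 7 1) (Fin.castAdd 7 2) (Fin.castAdd 7 3) = 0 := by
    have := h312; rw [hcc, hcs] at this  -- c 3 1 2 → c 1 3 2 → c 1 2 3
    exact this
  have h124 : c (Fin.castAdd 7 1) (Fin.castAdd 7 2) (Fin.castAdd 7 4) = 0 := by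
    have := h412; rw [hcc, hcs] at this
    exact this
  rw [hcc]  -- goal: c 1 a b = 0
  rcases ha with rfl | rfl | rfl <;> rcases hb with rfl | rfl | rfl
  · exact hcd _ _
  · exact h123
  · exact h124
  · rw [hcs]; exact h123
  · exact hcd _ _
  · exact h134
  · rw [hcs]; exact h124
  · rw [hcs]; exact h134
  · exact hcd _ _

/-- **The scalar identities and (R)** of E1280-HANDPROOFS §2.4(ii), in the form consumed by `tpl_R4_Z_rank4_core` / `tpl_R4_Z_rank6_core`
(`g₁ = c_{y v₀ v₁}`, `c₂₃ = c_{y v₂ v₃}`, `κ_t[m] = c_{v₀ v_t z_m}`, `N_{jk} = c_{v₀ z_j z_k}`, `y_t = Y t`). [this work] -/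
theorem tpc4_scalars :
    (c (Fin.castAdd 7 0) (Fin.castAdd 7 1) (Fin.castAdd 7 2) + c (Fin.castAdd 7 0) (Fin.castAdd 7 3) (Fin.castAdd 7 4) = 1) ∧
    (c (Fin.castAdd 7 0) (Fin.castAdd 7 1) (Fin.castAdd 7 2) +
      (∑ m, Y 0 m * c (Fin.castAdd 7 1) (Fin.castAdd 7 (Fin.natAdd 2 (0 : Fin 3))) (Fin.natAdd 5 m)) = 1) ∧
    (c (Fin.castAdd 7 0) (Fin.castAdd 7 3) (Fin.castAdd 7 4) +
      (∑ m, Y 1 m * c (Fin.castAdd 7 1) (Fin.castAdd 7 (Fin.natAdd 2 (1 : Fin 3))) (Fin.natAdd 5 m)) = 1) ∧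
    (c (Fin.castAdd 7 0) (Fin.castAdd 7 3) (Fin.castAdd 7 4) +
      (∑ m, Y 2 m * c (Fin.castAdd 7 1) (Fin.castAdd 7 (Fin.natAdd 2 (2 : Fin 3))) (Fin.natAdd 5 m)) = 1) ∧
    ((∑ m, Y 0 m * c (Fin.castAdd 7 1) (Fin.castAdd 7 (Fin.natAdd 2 (1 : Fin 3))) (Fin.natAdd 5 m)) = 0) ∧
    ((∑ m, Y 2 m * c (Fin.castAdd 7 1) (Fin.castAdd 7 (Fin.natAdd 2 (1 : Fin 3))) (Fin.natAdd 5 m)) = 0) ∧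
    ((∑ m, Y 0 m * c (Fin.castAdd 7 1) (Fin.castAdd 7 (Fin.natAdd 2 (2 : Fin 3))) (Fin.natAdd 5 m)) = 0) ∧
    ((∑ m, Y 1 m * c (Fin.castAdd 7 1) (Fin.castAdd 7 (Fin.natAdd 2 (2 : Fin 3))) (Fin.natAdd 5 m)) = 0) ∧
    (c (Fin.castAdd 7 0) (Fin.castAdd 7 1) (Fin.castAdd 7 2) +
      (∑ i : Fin 7, ∑ j : Fin 7, (if i < j then c (Fin.castAdd 7 1) (Fin.natAdd 5 i) (Fin.natAdd 5 j) * Ξ i j else 0)) +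
      (∑ t : Fin 3, ∑ m, Y t m * c (Fin.castAdd 7 1) (Fin.castAdd 7 (Fin.natAdd 2 t)) (Fin.natAdd 5 m)) = 1) ∧
    (∀ (t : Fin 3) (j : Fin 7), (∑ s, Ξ j s * c (Fin.castAdd 7 1) (Fin.castAdd 7 (Fin.natAdd 2 t)) (Fin.natAdd 5 s)) = 0) := by
  obtain ⟨h134, -, h312, h412, hyy⟩ := tpc4_cvvv c d hcs hcc hcd hpair hdy_κκ hdy_κσ hdy_σσ
  have hc := tpc4_diag12 c hcs hcc hcd
  have kvt := tpc4_key_vt c d hpair Y hdv_κκ hdv_κσ hdv_σσ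
  have kv0 := tpc4_key_v0 c d hpair Ξ Y hdv0_κκ hdv0_κσ hdv0_σσ
  have kz := tpc4_key_z c d hpair Ξ Y hdz_κκ hdz_κσ hdz_σσ
  have cv0 := tpc4_cv0vv c hcs hcc hcd h134 h312 h412
  have n0 : (Fin.natAdd 2 (0 : Fin 3) : Fin 5) = 2 := by decide
  have n1 : (Fin.natAdd 2 (1 : Fin 3) : Fin 5) = 3 := by decide
  have n2 : (Fin.natAdd 2 (2 : Fin 3) : Fin 5) = 4 := by decide
  have e0 : (![1, 4, 3] : Fin 3 → Fin 5) 0 = 1 := rfl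
  have e1 : (![1, 4, 3] : Fin 3 → Fin 5) 1 = 4 := rfl
  have e2 : (![1, 4, 3] : Fin 3 → Fin 5) 2 = 3 := rfl
  have neκ : ∀ a b : Fin 5, a ≠ b → (Fin.castAdd 7 a : Fin (5 + 7)) ≠ Fin.castAdd 7 b := fun a b h h' => h (Fin.castAdd_injective _ _ h')
  have neκσ : ∀ (a : Fin 5) (j : Fin 7), (Fin.castAdd 7 a : Fin (5 + 7)) ≠ Fin.natAdd 5 j := fun a j h => by
    have := congrArg Fin.val h; simp only [Fin.val_castAdd, Fin.val_natAdd] at this; omega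
  -- the sums Σ_s c p v₀ σs * Y t s rewritten with c v₀ p σs
  have hsum : ∀ (a : Fin 5) (t : Fin 3), (∑ s, c (Fin.castAdd 7 a) (Fin.castAdd 7 1) (Fin.natAdd 5 s) * Y t s) =
      ∑ m, Y t m * c (Fin.castAdd 7 1) (Fin.castAdd 7 a) (Fin.natAdd 5 m) :=
    fun a t => Finset.sum_congr rfl fun s _ => by rw [hcc, mul_comm]
  -- g₂ = g₃ = 0 from (v₀, v₃), (v₀, v₂)
  have hg3 : c (Fin.castAdd 7 0) (Fin.castAdd 7 1) (Fin.castAdd 7 4) = 0 := by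
    have h := kvt 1 (Fin.castAdd 7 1)
    rw [e1, n1, if_neg (neκ 1 3 (by decide))] at h
    simp only [(hc _ _).1, zero_mul, Finset.sum_const_zero, add_zero] at h
    rw [hcc] at h; exact h
  have hg2 : c (Fin.castAdd 7 0) (Fin.castAdd 7 1) (Fin.castAdd 7 3) = 0 := by
    have h := kvt 2 (Fin.castAdd 7 1)
    rw [e2, n2, if_neg (neκ 1 4 (by decide))] at h
    simp only [(hc _ _).1, zero_mul, Finset.sum_const_zero, add_zero] at h
    rw [hcc] at h; exact h
  refine ⟨hyy, ?_, ?_, ?_, ?_, ?_, ?_, ?_, ?_, ?_⟩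
  · -- (v₁, v₁)
    have h := kvt 0 (Fin.castAdd 7 2)
    rw [e0, n0, if_pos rfl, hsum] at h
    rw [n0, ← h, hcc (Fin.castAdd 7 0) (Fin.castAdd 7 2) (Fin.castAdd 7 1), hcs (Fin.castAdd 7 0) (Fin.castAdd 7 1) (Fin.castAdd 7 2)]
  · -- (v₂, v₂)
    have h := kvt 1 (Fin.castAdd 7 3)
    rw [e1, n1, if_pos rfl, hsum] at h
    rw [n1, ← h, hcc (Fin.castAdd 7 0) (Fin.castAdd 7 3) (Fin.castAdd 7 4)]
  · -- (v₃, v₃)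
    have h := kvt 2 (Fin.castAdd 7 4)
    rw [e2, n2, if_pos rfl, hsum] at h
    rw [n2, ← h, hcc (Fin.castAdd 7 0) (Fin.castAdd 7 4) (Fin.castAdd 7 3), hcs (Fin.castAdd 7 0) (Fin.castAdd 7 3) (Fin.castAdd 7 4)]
  · -- (v₂, v₁)
    have h := kvt 0 (Fin.castAdd 7 3)
    rw [e0, n0, if_neg (neκ 3 2 (by decide)), hsum, hcc (Fin.castAdd 7 0) (Fin.castAdd 7 3) (Fin.castAdd 7 1),
      hcs (Fin.castAdd 7 0) (Fin.castAdd 7 1) (Fin.castAdd 7 3), hg2, zero_add] at h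
    rw [n1]; exact h
  · -- (v₂, v₃)
    have h := kvt 2 (Fin.castAdd 7 3)
    rw [e2, n2, if_neg (neκ 3 4 (by decide)), hsum, (hc _ _).2, zero_add] at h
    rw [n1]; exact h
  · -- (v₃, v₁)
    have h := kvt 0 (Fin.castAdd 7 4)
    rw [e0, n0, if_neg (neκ 4 2 (by decide)), hsum, hcc (Fin.castAdd 7 0) (Fin.castAdd 7 4) (Fin.castAdd 7 1),
      hcs (Fin.castAdd 7 0) (Fin.castAdd 7 1) (Fin.castAdd 7 4), hg3, zero_add] at h
    rw [n2]; exact h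
  · -- (v₃, v₂)
    have h := kvt 1 (Fin.castAdd 7 4)
    rw [e1, n1, if_neg (neκ 4 3 (by decide)), hsum, (hc _ _).2, zero_add] at h
    rw [n2]; exact h
  · -- (v₀, v₀)
    have h := kv0 (Fin.castAdd 7 1)
    rw [if_pos rfl, hcc (Fin.castAdd 7 0) (Fin.castAdd 7 1) (Fin.castAdd 7 2)] at h
    rw [← h, add_assoc, add_assoc]
    congr 1
    rw [add_comm]
    congr 1
    refine Finset.sum_congr rfl fun t _ => Finset.sum_congr rfl fun m _ => ?_
    exact mul_comm _ _
  · -- (R): (v_t, z_j)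
    intro t j
    have h := kz j (Fin.castAdd 7 (Fin.natAdd 2 t))
    rw [if_neg (neκσ _ _)] at h
    have hvv : (∑ t' : Fin 3, c (Fin.castAdd 7 (Fin.natAdd 2 t)) (Fin.castAdd 7 1) (Fin.castAdd 7 (Fin.natAdd 2 t')) * Y t' j) = 0 :=
      Finset.sum_eq_zero fun t' _ => by
        rw [cv0 _ _ (by fin_cases t <;> decide) (by fin_cases t' <;> decide), zero_mul]
    rw [hvv, zero_add] at h
    rw [← h]
    exact Finset.sum_congr rfl fun s _ => by rw [hcc (Fin.castAdd 7 1) (Fin.castAdd 7 (Fin.natAdd 2 t)) (Fin.natAdd 5 s), mul_comm]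

end R4Z

end Summit.QuantumAdvantage.QuantumAdvantage.Theorems.CubicForrelation.NearExactIsExact
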